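import Summits.Ventures.YMGap.RobustBall.CouplingDerivativeOnBallS
import HarnessLib

/-!
# Venture YMGap, track ROBUST-BALL (Y2) — TIER 2: the `SU(2)` quarter inputs of the pair door, packaged once

HONEST FRAMING. WHAT THIS IS: a venture file (cell `pub-ymgap`, track Y2 ROBUST-BALL, seat rb-p1, theorems only), pure bookkeeping used by the
`SU(2)`, `d = 4` cells of the regularity files: at 't Hooft coupling `β_W/4` (bare `β_W/2`) the one-link Poincaré modulus `2/3`
(`oneLinkPoincareSUN_two_sharp`), the variance modulus `(2/3)·2²` (`linVariance_of_poincare`) and the pair-door inequality in the schema's shape from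
`6|β_W| e^{a'} e^{t} + e^{a'/2} √(2/3) Λ' < 1`.
* `su2_pairDoor_inputs`.
WHAT THIS IS NOT: anything new mathematically; nothing continuum / Clay.
-/

noncomputable section

open MeasureTheory Function Finset ProbabilityTheory Real
open scoped NNReal
open Literature.Probability.LatticeModels
open Literature.Probability.LatticeModels.DobrushinMetric
open Literature.MathematicalPhysics.QuantumLattice
open Literature.MathematicalPhysics.QuantumFieldTheory hiding ZdEdge
open Summit.QuantumFields.BalabanUV.InfraRed.StrongCouplingPoincareDoorSUN (oneLinkPoincareSUN_two_sharp)

namespace Summit.Ventures.YMGap.RobustBall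

/-- The `SU(2)` quarter inputs of the pair door at 't Hooft coupling `β_W/4`: Poincaré modulus `2/3`, variance modulus `(2/3)·2²`, and the door
inequality in the schema's shape. -/
theorem su2_pairDoor_inputs {βW a' Λ' t : ℝ} (hρ : 6 * |βW| * (exp a' * exp t) + exp (a' / 2) * Real.sqrt (2 / 3) * Λ' < 1) :
    (∀ B : Matrix (Fin 2) (Fin 2) ℂ, matrixOpNorm B ≤ |βW / 4| * (2 * (((4 : ℕ) : ℝ) - 1)) →
      ∀ (ψ : Matrix.specialUnitaryGroup (Fin 2) ℂ → ℝ) (M : ℝ), 0 ≤ M →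
        (∀ x y, |ψ x - ψ y| ≤ M * suFrobDist x y) →
        Var[ψ; (haarProbability (Matrix.specialUnitaryGroup (Fin 2) ℂ)).tilted
          fun g => ((2 : ℕ) : ℝ) * ((g : Matrix (Fin 2) (Fin 2) ℂ) * B).trace.re] ≤ 2 / 3 * M ^ 2) ∧
    (∀ B : Matrix (Fin 2) (Fin 2) ℂ, matrixOpNorm B ≤ |βW / 4| * (2 * (((4 : ℕ) : ℝ) - 1)) → ∀ Δ : Matrix (Fin 2) (Fin 2) ℂ,
      Var[fun g : Matrix.specialUnitaryGroup (Fin 2) ℂ =>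
          ((2 : ℕ) : ℝ) * ((g : Matrix (Fin 2) (Fin 2) ℂ) * Δ).trace.re;
        (haarProbability (Matrix.specialUnitaryGroup (Fin 2) ℂ)).tilted
          fun g => ((2 : ℕ) : ℝ) * ((g : Matrix (Fin 2) (Fin 2) ℂ) * B).trace.re] ≤ 2 / 3 * ((2 : ℕ) : ℝ) ^ 2 * frobNorm Δ ^ 2) ∧
    6 * (((4 : ℕ) : ℝ) - 1) * |βW / 4| * (exp a' * exp t * Real.sqrt (2 / 3 * (2 / 3 * ((2 : ℕ) : ℝ) ^ 2))) +
      exp (a' / 2) * Real.sqrt (2 / 3) * Λ' < 1 := by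
  have hP : ∀ B : Matrix (Fin 2) (Fin 2) ℂ, matrixOpNorm B ≤ |βW / 4| * (2 * (((4 : ℕ) : ℝ) - 1)) →
      ∀ (ψ : Matrix.specialUnitaryGroup (Fin 2) ℂ → ℝ) (M : ℝ), 0 ≤ M →
        (∀ x y, |ψ x - ψ y| ≤ M * suFrobDist x y) →
        Var[ψ; (haarProbability (Matrix.specialUnitaryGroup (Fin 2) ℂ)).tilted
          fun g => ((2 : ℕ) : ℝ) * ((g : Matrix (Fin 2) (Fin 2) ℂ) * B).trace.re] ≤ 2 / 3 * M ^ 2 :=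
    fun B hB ψ M hM hψ => oneLinkPoincareSUN_two_sharp _ B hB ψ M hM hψ
  refine ⟨hP, linVariance_of_poincare (N := 2) hP, ?_⟩
  have hsq : Real.sqrt (2 / 3 * (2 / 3 * ((2 : ℕ) : ℝ) ^ 2)) = 4 / 3 := by
    rw [show (2 / 3 * (2 / 3 * ((2 : ℕ) : ℝ) ^ 2) : ℝ) = (4 / 3) ^ 2 by norm_num, Real.sqrt_sq (by norm_num)]
  rw [hsq, abs_div, abs_of_pos (by norm_num : (0 : ℝ) < 4)]
  have : 6 * (((4 : ℕ) : ℝ) - 1) * (|βW| / 4) * (exp a' * exp t * (4 / 3)) = 6 * |βW| * (exp a' * exp t) := by norm_num; ring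
  rw [this]; exact hρ


end Summit.Ventures.YMGap.RobustBall

end
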